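import Literature.MathematicalPhysics.QuantumFieldTheory.Balaban1983to89.T4HaarUnitaryLocalDiffeo

/-!
# Lemma A on `SU(N)`: Haar-absolute continuity of push-forwards under maps with injective tangent derivative

Companion to `Balaban1983to89.T4HaarUnitaryLocalDiffeo` (the `U(N)` statement
`haar_restrict_map_absolutelyContinuous_unitary`).  This file transfers that statement to the special unitary group:

**Main theorem** (`haar_restrict_map_absolutelyContinuous_specialUnitary`, every `N ≥ 1`).  Let `S ⊆ SU(N)` be open and
`K : SU(N) → SU(N)` measurable.  Suppose an ambient map `Kmat : M_N(ℂ) → M_N(ℂ)` has a strict real Fréchet derivative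
`D W` at `↑W` for every `W ∈ S`, `Kmat ↑W = ↑(K W)` on `S`, and `D W` is injective on the tangent space `W · 𝔰𝔲(N)`:
`∀ X, Xᴴ = -X → tr X = 0 → D W (W X) = 0 → X = 0`.  Then `((haarProbability SU(N)).restrict S).map K ≪ haarProbability SU(N)`.
Corollary `haar_map_absolutelyContinuous_specialUnitary` (`S = univ`).

This is the map-independent half of a fibre lemma on `SU(N)` (the other half being the tangent injectivity of a
specific map, e.g. the exp-mean-log block average); cf. the `SU(2)` instance `T4HaarSU2LocalDiffeo` /
`T4EMLFibreAC`.  Everything here is standard finite-dimensional measure theory and matrix calculus; every declaration is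
tagged [folklore]; nothing printed is asserted.  The consumer-side measure `HaarData.haar` of the lattice-gauge files is
`haarProbability` by `rfl`, and the hypotheses are norm-independent (`HasStrictFDerivAt` and `→L[ℝ]` only see the topology),
so the theorem applies verbatim in the `Matrix.Norms.L2Operator` scope.

## The transfer

No chart of `SU(N)` is built.  Instead (`§B`) we use the projection `p : U(N) → SU(N)`, `p U = U · d(det U)⁻¹` with
`d(z) = diag(z, 1, …, 1)` (ambient polynomial formula `projM M = M · d((det M)‾)`), which is the identity on `SU(N)` and LEFT
`SU(N)`-EQUIVARIANT, so that `p_* Haar_{U(N)} = Haar_{SU(N)}` by uniqueness of the Haar probability measure (`§D`,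
`map_toSU_haarProbability`).  A map `K` on `SU(N)` lifts to `K̂ U = K(p U) · d(det U)` on `U(N)` with `p ∘ K̂ = K ∘ p`
(`toSU_lift`), hence `p⁻¹(K⁻¹ T ∩ S) = K̂⁻¹(p⁻¹ T) ∩ p⁻¹ S`, and the `U(N)` theorem applied to `K̂` on `p⁻¹ S` gives the
claim (`§E`) — once the tangent injectivity is transferred.

## The tangent injectivity of the lift (`§A`, `§C`, `lift_tangent_injective`)

With `W = p U`, `c = det U`, `A = K W` and the twisted tangent vector `X̃ = d(c) X d(c̄) − (tr X) E₀ ∈ 𝔰𝔲(N)` (`twist`),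
the derivative of the lift is `DK̂_U (U X) = (c · tr X) A E₀ + D W (W X̃) · d(c)` (`liftD_apply`, `projD_apply_mul`; the
derivative of `det` at `1` is the trace, `§A`, via the multilinear `detRows`).  If this vanishes then
`D W (W X̃) = −(tr X) A E₀`; the TANGENCY `tr (A* · D W (W X̃)) = 0` (`§C`, `trace_star_mul_apply_eq_zero`: differentiate
`t ↦ det (A* · Kmat (p (W cay (t X̃)))) ≡ 1` at `t = 0`, the curve staying in `S` for small `t`; the Cayley calculus is the
companion file's `hasStrictFDerivAt_cay`) forces `tr X = 0`, hence `D W (W X̃) = 0`, `X̃ = 0` by hypothesis, and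
`X = d(c̄) X̃ d(c) = 0`.

Technical note. The derivatives `projD`, `liftD` are DEFINED as Fréchet derivatives (`fderiv`) and computed pointwise at
unitary points (`projD_apply`, `liftD_apply`); equalities between continuous linear maps coming from different elaboration
paths of the matrix norm instances are always bridged definitionally (`exact`, `DFunLike.congr_fun`, a `calc` step), never by
rewriting.
-/

noncomputable section

open scoped Topology ENNReal
open Matrix MeasureTheory Set Function Filter

namespace Literature.MathematicalPhysics.QuantumFieldTheory.Balaban1983to89.T4HaarSUNLocalDiffeo

open scoped Matrix.Norms.Frobenius
open UnitaryCayley T4HaarUnitaryLocalDiffeo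

variable {N : ℕ}

local notation "𝕄" => Matrix (Fin N) (Fin N) ℂ


/-! ## A. The derivative of the determinant -/

section Det

/-- The determinant of a complex `N × N` matrix as a continuous `ℂ`-multilinear map of its rows. [folklore] -/
def detRows (N : ℕ) : ContinuousMultilinearMap ℂ (fun _ : Fin N => Fin N → ℂ) ℂ where
  toMultilinearMap := (Matrix.detRowAlternating : (Fin N → ℂ) [⋀^Fin N]→ₗ[ℂ] ℂ).toMultilinearMap
  cont := by
    change Continuous fun M : Matrix (Fin N) (Fin N) ℂ => M.det
    exact continuous_id.matrix_det

/-- `detRows` is the determinant of the matrix with the given rows. [folklore] -/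
theorem detRows_apply (v : Fin N → Fin N → ℂ) : detRows N v = (Matrix.of v).det := rfl

/-- The identity matrix with row `i` replaced by `b` has determinant `b i`. [folklore] -/
theorem det_updateRow_one (i : Fin N) (b : Fin N → ℂ) : ((1 : 𝕄).updateRow i b).det = b i := by
  rw [← Matrix.det_transpose, ← Matrix.updateCol_transpose, Matrix.transpose_one, ← Matrix.cramer_apply,
    Matrix.cramer_one]
  rfl

/-- **The derivative of `det` at the identity is the trace**: `Σᵢ det (1 with row i ← Yᵢ) = tr Y`. [folklore] -/
theorem detRows_linearDeriv_one (Y : 𝕄) : (detRows N).linearDeriv (1 : 𝕄) Y = Y.trace := by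
  rw [ContinuousMultilinearMap.linearDeriv_apply]
  have h : ∀ i : Fin N, detRows N (update (1 : 𝕄) i (Y i)) = Y i i := fun i => det_updateRow_one i (Y i)
  simp_rw [h]
  rfl

/-- The real-linear functional `H ↦ tr H` realised as the (scalar-restricted) derivative of `det` at `1`. [folklore] -/
def trD := ((detRows N).linearDeriv (1 : 𝕄)).restrictScalars ℝ

/-- Pointwise: `trD H = tr H`. [folklore] -/
theorem trD_apply (H : 𝕄) : trD (N := N) H = H.trace := by
  show (detRows N).linearDeriv (1 : 𝕄) H = _
  exact detRows_linearDeriv_one H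

/-- **`det` has strict real derivative `tr` at the identity.** [folklore] -/
theorem hasStrictFDerivAt_det_one : HasStrictFDerivAt (fun M : 𝕄 => M.det) (trD (N := N)) (1 : 𝕄) := by
  have h := ((detRows N).hasStrictFDerivAt (1 : 𝕄)).restrictScalars ℝ
  exact h

/-- The derivative of `det` at a unitary `U`: `H ↦ det U · tr (U* H)`. [folklore] -/
def detD (U : 𝕄) := U.det • (trD (N := N)).comp (ContinuousLinearMap.mul ℝ 𝕄 (star U))

/-- Pointwise: `detD U H = det U · tr (U* H)`. [folklore] -/
theorem detD_apply (U H : 𝕄) : detD U H = U.det * (star U * H).trace := by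
  show U.det • trD (N := N) (star U * H) = _
  rw [trD_apply, smul_eq_mul]

/-- **Jacobi at a unitary point**: for `U U* = 1 = U* U`, `det` has strict real derivative `H ↦ det U · tr (U* H)`
at `U` (from the derivative at `1` through `det M = det U · det (U* M)`). [folklore] -/
theorem hasStrictFDerivAt_det {U : 𝕄} (hU : U * star U = 1) (hU' : star U * U = 1) :
    HasStrictFDerivAt (fun M : 𝕄 => M.det) (detD U) U := by
  have hfun : (fun M : 𝕄 => M.det) = fun M => U.det * (star U * M).det := by
    funext M
    rw [← Matrix.det_mul, ← Matrix.mul_assoc, hU, Matrix.one_mul]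
  have h1 := hasStrictFDerivAt_det_one (N := N)
  rw [← hU'] at h1
  have h2 := (ContinuousLinearMap.mul ℝ 𝕄 (star U)).hasStrictFDerivAt (x := U)
  have h3 := (h1.comp U h2).const_mul U.det
  rw [hfun]
  exact h3

end Det

/-! ## B. The diagonal correction `d(z) = diag(z, 1, …, 1)`, the projection `U ↦ U d(det U)⁻¹` and the lift -/

section Incl

/-- For a unitary matrix, `det U · (det U)‾ = 1`. [folklore] -/
theorem det_mul_star_det {U : 𝕄} (hU : U ∈ Matrix.unitaryGroup (Fin N) ℂ) : U.det * star U.det = 1 := by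
  have h : U * star U = 1 := Matrix.mem_unitaryGroup_iff.mp hU
  have := congrArg Matrix.det h
  rwa [det_mul, star_eq_conjTranspose, det_conjTranspose, det_one] at this

/-- For a unitary matrix, `(det U)‾ · det U = 1`. [folklore] -/
theorem star_det_mul_det {U : 𝕄} (hU : U ∈ Matrix.unitaryGroup (Fin N) ℂ) : star U.det * U.det = 1 := by
  rw [mul_comm]; exact det_mul_star_det hU

/-- The inclusion `SU(N) → U(N)`. [folklore] -/
def incl (W : Matrix.specialUnitaryGroup (Fin N) ℂ) : 𝔾 N := ⟨W, (Matrix.mem_specialUnitaryGroup_iff.mp W.2).1⟩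

/-- The matrix of `incl W` is `W`. [folklore] -/
@[simp] theorem coe_incl (W : Matrix.specialUnitaryGroup (Fin N) ℂ) : (incl W : 𝕄) = W := rfl

/-- The inclusion `SU(N) → U(N)` is continuous. [folklore] -/
theorem continuous_incl : Continuous (incl (N := N)) :=
  Continuous.subtype_mk continuous_subtype_val _

end Incl

section Diag

variable [NeZero N]

/-- The elementary matrix `E₀ = e₀ e₀ᵀ`. [folklore] -/
def E₀ : 𝕄 := Matrix.of fun i j => if i = 0 ∧ j = 0 then (1 : ℂ) else 0

/-- Entries of `E₀`. [folklore] -/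
theorem E₀_apply (i j : Fin N) : (E₀ : 𝕄) i j = if i = 0 ∧ j = 0 then (1 : ℂ) else 0 := rfl

/-- The vector `(z, 1, …, 1)`. [folklore] -/
def dvec (z : ℂ) : Fin N → ℂ := update 1 0 z

/-- The diagonal correction `d(z) = diag(z, 1, …, 1)`. [folklore] -/
def dmat (z : ℂ) : 𝕄 := diagonal (dvec z)

/-- Entries of `(z, 1, …, 1)`. [folklore] -/
theorem dvec_apply (z : ℂ) (i : Fin N) : dvec z i = if i = 0 then z else 1 := by
  unfold dvec; rw [update_apply]; rfl

/-- `(z,1,…,1) · (w,1,…,1) = (zw,1,…,1)` (pointwise). [folklore] -/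
theorem dvec_mul (z w : ℂ) : dvec (N := N) z * dvec w = dvec (z * w) := by
  funext i; simp only [Pi.mul_apply, dvec_apply]; split_ifs <;> simp

/-- `(1, 1, …, 1) = 1`. [folklore] -/
theorem dvec_one : dvec (N := N) 1 = 1 := by
  funext i; simp only [dvec_apply, Pi.one_apply]; split_ifs <;> rfl

/-- `(z,1,…,1)‾ = (z̄,1,…,1)`. [folklore] -/
theorem star_dvec (z : ℂ) : star (dvec (N := N) z) = dvec (star z) := by
  funext i; simp only [Pi.star_apply, dvec_apply]; split_ifs <;> simp

/-- `d(z) d(w) = d(zw)`. [folklore] -/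
theorem dmat_mul_dmat (z w : ℂ) : dmat (N := N) z * dmat w = dmat (z * w) := by
  unfold dmat; rw [diagonal_mul_diagonal]; congr 1; funext i; exact congrFun (dvec_mul z w) i

/-- `d(1) = 1`. [folklore] -/
@[simp] theorem dmat_one : dmat (N := N) 1 = 1 := by
  unfold dmat; rw [dvec_one]; exact diagonal_one

/-- `d(z)ᴴ = d(z̄)`. [folklore] -/
theorem conjTranspose_dmat (z : ℂ) : (dmat (N := N) z)ᴴ = dmat (star z) := by
  unfold dmat; rw [diagonal_conjTranspose, star_dvec]

/-- `star d(z) = d(z̄)`. [folklore] -/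
theorem star_dmat (z : ℂ) : star (dmat (N := N) z) = dmat (star z) := conjTranspose_dmat z

/-- `det d(z) = z`. [folklore] -/
theorem det_dmat (z : ℂ) : (dmat (N := N) z).det = z := by
  unfold dmat dvec
  rw [det_diagonal, Finset.prod_update_of_mem (Finset.mem_univ _)]
  simp

/-- `tr E₀ = 1`. [folklore] -/
theorem trace_E₀ : (E₀ : 𝕄).trace = 1 := by
  simp [Matrix.trace, E₀_apply]

/-- `E₀ᴴ = E₀`. [folklore] -/
theorem conjTranspose_E₀ : (E₀ : 𝕄)ᴴ = E₀ := by
  ext i j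
  rw [conjTranspose_apply, E₀_apply, E₀_apply]
  by_cases hi : i = 0 <;> by_cases hj : j = 0 <;> simp [hi, hj]

/-- The affine form `d(z) = 1 + (z − 1) E₀` (used for calculus). [folklore] -/
theorem dmat_eq (z : ℂ) : dmat (N := N) z = 1 + (z - 1) • E₀ := by
  ext i j
  simp only [dmat, diagonal_apply, dvec_apply, Matrix.add_apply, Matrix.one_apply, Matrix.smul_apply, E₀_apply,
    smul_eq_mul]
  by_cases hij : i = j
  · subst hij
    by_cases hi : i = 0
    · simp [hi]
    · simp [hi]
  · have : ¬ (i = 0 ∧ j = 0) := fun h => hij (h.1.trans h.2.symm)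
    simp [hij, this]

/-- `d(z) E₀ = z E₀`. [folklore] -/
theorem dmat_mul_E₀ (z : ℂ) : dmat (N := N) z * E₀ = z • E₀ := by
  ext i j
  simp only [dmat, Matrix.diagonal_mul, dvec_apply, Matrix.smul_apply, E₀_apply, smul_eq_mul]
  by_cases hi : i = 0
  · simp [hi]
  · simp [hi]

/-- `E₀ d(z) = z E₀`. [folklore] -/
theorem E₀_mul_dmat (z : ℂ) : E₀ * dmat (N := N) z = z • E₀ := by
  ext i j
  simp only [dmat, Matrix.mul_diagonal, dvec_apply, Matrix.smul_apply, E₀_apply, smul_eq_mul]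
  by_cases hj : j = 0
  · simp [hj, mul_comm]
  · simp [hj]

/-- `d(z)` is unitary for `z z̄ = 1`. [folklore] -/
theorem dmat_mem_unitaryGroup {z : ℂ} (hz : z * star z = 1) : dmat (N := N) z ∈ Matrix.unitaryGroup (Fin N) ℂ := by
  rw [Matrix.mem_unitaryGroup_iff, star_dmat, dmat_mul_dmat, hz, dmat_one]

/-! ### The projection and the lift, as matrix maps -/

/-- The ambient projection formula `p(M) = M · d((det M)‾)` (on `U(N)`: `U ↦ U d(det U)⁻¹ ∈ SU(N)`). [folklore] -/
def projM (M : 𝕄) : 𝕄 := M * dmat (star M.det)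

/-- The ambient lift of a matrix map `Kmat`: `M ↦ Kmat (p M) · d(det M)`. [folklore] -/
def liftM (Kmat : 𝕄 → 𝕄) (M : 𝕄) : 𝕄 := Kmat (projM M) * dmat M.det

/-- `p` maps `U(N)` into `SU(N)`. [folklore] -/
theorem projM_mem {U : 𝕄} (hU : U ∈ Matrix.unitaryGroup (Fin N) ℂ) : projM U ∈ Matrix.specialUnitaryGroup (Fin N) ℂ := by
  rw [Matrix.mem_specialUnitaryGroup_iff]
  refine ⟨Submonoid.mul_mem _ hU (dmat_mem_unitaryGroup ?_), ?_⟩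
  · rw [star_star, star_det_mul_det hU]
  · unfold projM; rw [det_mul, det_dmat, det_mul_star_det hU]

/-- `p` fixes `SU(N)`. [folklore] -/
theorem projM_eq_self {W : 𝕄} (hW : W ∈ Matrix.specialUnitaryGroup (Fin N) ℂ) : projM W = W := by
  unfold projM; rw [(Matrix.mem_specialUnitaryGroup_iff.mp hW).2, star_one, dmat_one, Matrix.mul_one]

/-- `p` is left `SU(N)`-equivariant: `p(g U) = g p(U)` for `det g = 1`. [folklore] -/
theorem projM_mul {g U : 𝕄} (hg : g.det = 1) : projM (g * U) = g * projM U := by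
  unfold projM; rw [det_mul, hg, one_mul, Matrix.mul_assoc]

/-- **`p ∘ lift = K ∘ p`**: `p (Kmat (p U) d(det U)) = Kmat (p U)` when `Kmat (p U) ∈ SU(N)` and `U ∈ U(N)`. [folklore] -/
theorem projM_liftM {Kmat : 𝕄 → 𝕄} {U : 𝕄} (hU : U ∈ Matrix.unitaryGroup (Fin N) ℂ)
    (hK : Kmat (projM U) ∈ Matrix.specialUnitaryGroup (Fin N) ℂ) : projM (liftM Kmat U) = Kmat (projM U) := by
  have hdet : (Kmat (projM U)).det = 1 := (Matrix.mem_specialUnitaryGroup_iff.mp hK).2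
  show Kmat (projM U) * dmat U.det * dmat (star (Kmat (projM U) * dmat U.det).det) = Kmat (projM U)
  rw [det_mul, hdet, one_mul, det_dmat, Matrix.mul_assoc, dmat_mul_dmat, det_mul_star_det hU, dmat_one,
    Matrix.mul_one]

/-! ### The group-level maps -/

/-- The projection `U(N) → SU(N)`, `U ↦ U d(det U)⁻¹`. [folklore] -/
def toSU (U : 𝔾 N) : Matrix.specialUnitaryGroup (Fin N) ℂ := ⟨projM U, projM_mem U.2⟩

/-- The matrix of `p U` is `projM U`. [folklore] -/
@[simp] theorem coe_toSU (U : 𝔾 N) : (toSU U : 𝕄) = projM U := rfl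

/-- `p` restricted to `SU(N)` is the identity. [folklore] -/
theorem toSU_incl (W : Matrix.specialUnitaryGroup (Fin N) ℂ) : toSU (incl W) = W :=
  Subtype.ext (projM_eq_self W.2)

/-- `p` is left `SU(N)`-equivariant: `p (g U) = g · p U`. [folklore] -/
theorem toSU_incl_mul (g : Matrix.specialUnitaryGroup (Fin N) ℂ) (U : 𝔾 N) : toSU (incl g * U) = g * toSU U :=
  Subtype.ext (by
    show projM ((g : 𝕄) * (U : 𝕄)) = (g : 𝕄) * projM (U : 𝕄)
    exact projM_mul (Matrix.mem_specialUnitaryGroup_iff.mp g.2).2)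

/-- The diagonal correction as an element of `U(N)`. [folklore] -/
def dG (U : 𝔾 N) : 𝔾 N := ⟨dmat (U : 𝕄).det, dmat_mem_unitaryGroup (det_mul_star_det U.2)⟩

/-- The matrix of `dG U` is `d(det U)`. [folklore] -/
@[simp] theorem coe_dG (U : 𝔾 N) : (dG U : 𝕄) = dmat (U : 𝕄).det := rfl

/-- The lift of `K : SU(N) → SU(N)` to `U(N)`: `U ↦ K(p U) · d(det U)`. [folklore] -/
def lift (K : Matrix.specialUnitaryGroup (Fin N) ℂ → Matrix.specialUnitaryGroup (Fin N) ℂ) (U : 𝔾 N) : 𝔾 N :=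
  incl (K (toSU U)) * dG U

/-- The matrix of `lift K U` is `K(p U) · d(det U)`. [folklore] -/
theorem coe_lift (K : Matrix.specialUnitaryGroup (Fin N) ℂ → Matrix.specialUnitaryGroup (Fin N) ℂ) (U : 𝔾 N) :
    (lift K U : 𝕄) = (K (toSU U) : 𝕄) * dmat (U : 𝕄).det := rfl

/-- **`p (lift K U) = K (p U)`.** [folklore] -/
theorem toSU_lift (K : Matrix.specialUnitaryGroup (Fin N) ℂ → Matrix.specialUnitaryGroup (Fin N) ℂ) (U : 𝔾 N) :
    toSU (lift K U) = K (toSU U) := by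
  apply Subtype.ext
  show projM ((K (toSU U) : 𝕄) * dmat (U : 𝕄).det) = K (toSU U)
  have hdet : ((K (toSU U)) : 𝕄).det = 1 := (Matrix.mem_specialUnitaryGroup_iff.mp (K (toSU U)).2).2
  unfold projM
  rw [det_mul, hdet, one_mul, det_dmat, Matrix.mul_assoc, dmat_mul_dmat, det_mul_star_det U.2, dmat_one,
    Matrix.mul_one]

/-! ### Continuity and measurability -/

/-- `z ↦ d(z)` is continuous. [folklore] -/
theorem continuous_dmat : Continuous (dmat (N := N)) := by
  have : (dmat (N := N)) = fun z => 1 + (z - 1) • E₀ := funext dmat_eq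
  rw [this]; fun_prop

/-- The projection formula is continuous. [folklore] -/
theorem continuous_projM : Continuous (projM (N := N)) := by
  unfold projM
  exact continuous_id.mul (continuous_dmat.comp (continuous_star.comp (continuous_id.matrix_det)))

/-- `p : U(N) → SU(N)` is continuous. [folklore] -/
theorem continuous_toSU : Continuous (toSU (N := N)) :=
  Continuous.subtype_mk (continuous_projM.comp continuous_subtype_val) _

/-- `U ↦ d(det U)` is continuous on `U(N)`. [folklore] -/
theorem continuous_dG : Continuous (dG (N := N)) :=
  Continuous.subtype_mk (continuous_dmat.comp (continuous_subtype_val.matrix_det)) _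

/-- The lift of a measurable `K` is measurable. [folklore] -/
theorem measurable_lift {K : Matrix.specialUnitaryGroup (Fin N) ℂ → Matrix.specialUnitaryGroup (Fin N) ℂ}
    (hK : Measurable K) : Measurable (lift K) :=
  (continuous_incl.measurable.comp (hK.comp continuous_toSU.measurable)).mul continuous_dG.measurable

/-! ### Calculus of the projection and of the lift -/

/-- The derivative of `M ↦ d((det M)‾)` at a unitary `U`: `H ↦ (det U · tr (U* H))‾ E₀`. [folklore] -/
def dstarD (U : 𝕄) := ((Complex.conjCLE : ℂ →L[ℝ] ℂ).comp (detD U)).smulRight (E₀ : 𝕄)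

/-- Pointwise: `dstarD U H = (det U · tr (U* H))‾ E₀`. [folklore] -/
theorem dstarD_apply (U H : 𝕄) : dstarD U H = star (U.det * (star U * H).trace) • (E₀ : 𝕄) := by
  show ((Complex.conjCLE : ℂ →L[ℝ] ℂ) (detD U H)) • (E₀ : 𝕄) = _
  rw [detD_apply]
  rfl

/-- `M ↦ d((det M)‾)` has strict real derivative `dstarD U` at a unitary `U`. [folklore] -/
theorem hasStrictFDerivAt_dmat_star_det {U : 𝕄} (hU : U * star U = 1) (hU' : star U * U = 1) :
    HasStrictFDerivAt (fun M : 𝕄 => dmat (star M.det)) (dstarD U) U := by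
  have hfun : (fun M : 𝕄 => dmat (star M.det)) = fun M => 1 + ((Complex.conjCLE : ℂ →L[ℝ] ℂ) M.det - 1) • (E₀ : 𝕄) := by
    funext M; rw [dmat_eq]; rfl
  rw [hfun]
  exact ((((Complex.conjCLE : ℂ →L[ℝ] ℂ).hasStrictFDerivAt.comp U (hasStrictFDerivAt_det hU hU')).sub_const 1).smul_const
    (E₀ : 𝕄)).const_add 1

/-- The derivative of the projection formula `p(M) = M d((det M)‾)` at `U` (as a Fréchet derivative; computed at unitary
`U` in `projD_apply`). [folklore] -/
def projD (U : 𝕄) := fderiv ℝ (projM (N := N)) U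

/-- **The projection formula is strictly differentiable at every unitary `U`**, with derivative `projD U`. [folklore] -/
theorem hasStrictFDerivAt_projM {U : 𝕄} (hU : U * star U = 1) (hU' : star U * U = 1) :
    HasStrictFDerivAt (projM (N := N)) (projD U) U := by
  have h : HasStrictFDerivAt (projM (N := N)) _ U :=
    (hasStrictFDerivAt_id U).mul' (hasStrictFDerivAt_dmat_star_det hU hU')
  have e : projD U = _ := h.hasFDerivAt.fderiv
  rw [e]
  exact h

/-- `Dp_U (H) = U · (DdstarD_U H) + H · d((det U)‾)` at a unitary `U`. [folklore] -/
theorem projD_apply {U : 𝕄} (hU : U * star U = 1) (hU' : star U * U = 1) (H : 𝕄) :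
    projD U H = U * dstarD U H + H * dmat (star U.det) := by
  have h : HasStrictFDerivAt (projM (N := N)) _ U :=
    (hasStrictFDerivAt_id U).mul' (hasStrictFDerivAt_dmat_star_det hU hU')
  exact DFunLike.congr_fun h.hasFDerivAt.fderiv H

/-- The twisted tangent vector `X̃ = d(c) X d(c̄) − (tr X) E₀` (`c = det U`): `Dp_U (U X) = p(U) X̃`. [folklore] -/
def twist (c : ℂ) (X : 𝕄) : 𝕄 := dmat c * X * dmat (star c) - X.trace • E₀

/-- **`Dp_U (U X) = p(U) · X̃`** for unitary `U` and skew `X`. [folklore] -/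
theorem projD_apply_mul {U : 𝕄} (hU : U ∈ Matrix.unitaryGroup (Fin N) ℂ) {X : 𝕄} (hX : Xᴴ = -X) :
    projD U (U * X) = projM U * twist U.det X := by
  have hU' : star U * U = 1 := Matrix.mem_unitaryGroup_iff'.mp hU
  have hcc : U.det * star U.det = 1 := det_mul_star_det hU
  have htr : star X.trace = -X.trace := by
    rw [← Matrix.trace_conjTranspose, hX, Matrix.trace_neg]
  rw [projD_apply (Matrix.mem_unitaryGroup_iff.mp hU) hU', dstarD_apply, ← Matrix.mul_assoc (star U), hU',
    Matrix.one_mul, star_mul', htr]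
  have h1 : projM U * (dmat U.det * X * dmat (star U.det)) = U * X * dmat (star U.det) := by
    unfold projM
    rw [Matrix.mul_assoc U (dmat _), ← Matrix.mul_assoc (dmat (star U.det)) (dmat U.det * X),
      ← Matrix.mul_assoc (dmat (star U.det)) (dmat U.det), dmat_mul_dmat, mul_comm (star U.det), hcc, dmat_one,
      Matrix.one_mul, Matrix.mul_assoc]
  have h2 : projM U * (X.trace • (E₀ : 𝕄)) = (X.trace * star U.det) • (U * E₀) := by
    unfold projM
    rw [Matrix.mul_smul, Matrix.mul_assoc, dmat_mul_E₀, Matrix.mul_smul, smul_smul]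
  unfold twist
  rw [Matrix.mul_sub, h1, h2, Matrix.mul_smul, mul_neg, neg_smul, mul_comm (star U.det), sub_eq_add_neg, add_comm]

/-- `X̃` is skew-Hermitian when `X` is and `c c̄ = 1`. [folklore] -/
theorem conjTranspose_twist {c : ℂ} {X : 𝕄} (hX : Xᴴ = -X) : (twist c X)ᴴ = -twist c X := by
  have htr : star X.trace = -X.trace := by
    rw [← Matrix.trace_conjTranspose, hX, Matrix.trace_neg]
  unfold twist
  rw [Matrix.conjTranspose_sub, Matrix.conjTranspose_mul, Matrix.conjTranspose_mul, conjTranspose_dmat,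
    conjTranspose_dmat, star_star, hX, Matrix.conjTranspose_smul, conjTranspose_E₀, htr, neg_smul, Matrix.neg_mul,
    Matrix.mul_neg, ← Matrix.mul_assoc, neg_sub_neg, neg_sub]

/-- `X̃` is traceless when `c̄ c = 1`. [folklore] -/
theorem trace_twist {c : ℂ} (hc : star c * c = 1) (X : 𝕄) : (twist c X).trace = 0 := by
  unfold twist
  rw [Matrix.trace_sub, Matrix.trace_mul_cycle, dmat_mul_dmat, hc, dmat_one, Matrix.one_mul, Matrix.trace_smul,
    trace_E₀, smul_eq_mul, mul_one, sub_self]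

/-- `d(c̄) X̃ d(c) = X` when `tr X = 0` and `c c̄ = 1 = c̄ c`. [folklore] -/
theorem dmat_mul_twist_mul_dmat {c : ℂ} (hc' : star c * c = 1) {X : 𝕄} (htr : X.trace = 0) :
    dmat (star c) * twist c X * dmat c = X := by
  unfold twist
  rw [htr, zero_smul, sub_zero, ← Matrix.mul_assoc, ← Matrix.mul_assoc, dmat_mul_dmat, hc', dmat_one, Matrix.one_mul,
    Matrix.mul_assoc, dmat_mul_dmat, hc', dmat_one, Matrix.mul_one]

/-- The derivative of the lift `M ↦ Kmat (p M) d(det M)` at `U` (as a Fréchet derivative; computed at unitary `U` in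
`liftD_apply`). [folklore] -/
def liftD (Kmat : 𝕄 → 𝕄) (U : 𝕄) := fderiv ℝ (liftM Kmat) U

/-- `M ↦ d(det M)` has strict real derivative `H ↦ (det U · tr (U* H)) E₀` at a unitary `U`. [folklore] -/
theorem hasStrictFDerivAt_dmat_det {U : 𝕄} (hU : U * star U = 1) (hU' : star U * U = 1) :
    HasStrictFDerivAt (fun M : 𝕄 => dmat M.det) ((detD U).smulRight (E₀ : 𝕄)) U := by
  have hfun : (fun M : 𝕄 => dmat M.det) = fun M => 1 + (M.det - 1) • (E₀ : 𝕄) := funext fun M => dmat_eq _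
  rw [hfun]
  exact (((hasStrictFDerivAt_det hU hU').sub_const 1).smul_const (E₀ : 𝕄)).const_add 1

/-- **The lift is strictly differentiable at every unitary `U`** (given a strict derivative of `Kmat` at `p U`), with derivative `liftD Kmat U`. [folklore] -/
theorem hasStrictFDerivAt_liftM {Kmat : 𝕄 → 𝕄} {DW : 𝕄 →L[ℝ] 𝕄} {U : 𝕄} (hU : U ∈ Matrix.unitaryGroup (Fin N) ℂ)
    (hK : HasStrictFDerivAt Kmat DW (projM U)) : HasStrictFDerivAt (liftM Kmat) (liftD Kmat U) U := by
  have hU1 : U * star U = 1 := Matrix.mem_unitaryGroup_iff.mp hU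
  have hU2 : star U * U = 1 := Matrix.mem_unitaryGroup_iff'.mp hU
  have h : HasStrictFDerivAt (liftM Kmat) _ U :=
    (hK.comp U (hasStrictFDerivAt_projM hU1 hU2)).mul' (hasStrictFDerivAt_dmat_det hU1 hU2)
  have e : liftD Kmat U = _ := h.hasFDerivAt.fderiv
  rw [e]
  exact h

/-- `DK̂_U (H) = Kmat (p U) · (Ddet_U H) E₀ + DW (Dp_U H) · d(det U)` at a unitary `U`. [folklore] -/
theorem liftD_apply {Kmat : 𝕄 → 𝕄} {DW : 𝕄 →L[ℝ] 𝕄} {U : 𝕄} (hU : U ∈ Matrix.unitaryGroup (Fin N) ℂ)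
    (hK : HasStrictFDerivAt Kmat DW (projM U)) (H : 𝕄) :
    liftD Kmat U H = Kmat (projM U) * (detD U H • (E₀ : 𝕄)) + DW (projD U H) * dmat U.det := by
  have hU1 : U * star U = 1 := Matrix.mem_unitaryGroup_iff.mp hU
  have hU2 : star U * U = 1 := Matrix.mem_unitaryGroup_iff'.mp hU
  have h : HasStrictFDerivAt (liftM Kmat) _ U :=
    (hK.comp U (hasStrictFDerivAt_projM hU1 hU2)).mul' (hasStrictFDerivAt_dmat_det hU1 hU2)
  exact DFunLike.congr_fun h.hasFDerivAt.fderiv H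

end Diag

/-! ## C. Tangency: `tr ((K W)* · D W (W X̃)) = 0` for `X̃ ∈ 𝔰𝔲(N)` -/

section Tangency

variable [NeZero N]

omit [NeZero N] in
/-- `(2 : M_N(ℂ))⁻¹ = ½ · 1`. [folklore] -/
theorem inv_two : (2 : 𝕄)⁻¹ = (2⁻¹ : ℂ) • (1 : 𝕄) := by
  apply Matrix.inv_eq_left_inv
  rw [Matrix.smul_mul, Matrix.one_mul, show (2 : 𝕄) = (2 : ℂ) • (1 : 𝕄) by rw [two_smul, one_add_one_eq_two],
    smul_smul, inv_mul_cancel₀ (two_ne_zero : (2 : ℂ) ≠ 0), one_smul]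

omit [NeZero N] in
/-- The derivative of the Cayley transform at `0` is the identity: `cayD 0 Y = Y`. [folklore] -/
theorem cayD_zero_apply (Y : 𝕄) : cayD (0 : 𝕄) Y = Y := by
  rw [cayD_apply, sub_zero, inv_two, Matrix.smul_mul, Matrix.mul_smul, Matrix.one_mul, Matrix.mul_one, smul_smul,
    smul_smul]
  norm_num

omit [NeZero N] in
/-- A real multiple of a skew-Hermitian matrix is skew-Hermitian. [folklore] -/
theorem conjTranspose_real_smul {X : 𝕄} (hX : Xᴴ = -X) (t : ℝ) : (t • X)ᴴ = -(t • X) := by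
  rw [Matrix.conjTranspose_smul, star_trivial, hX, smul_neg]

/-- `twist 1 X = X` for traceless `X`. [folklore] -/
theorem twist_one {X : 𝕄} (htr : X.trace = 0) : twist 1 X = X := by
  unfold twist
  rw [htr, zero_smul, sub_zero, star_one, dmat_one, Matrix.one_mul, Matrix.mul_one]

/-- **TANGENCY.** If `Kmat` agrees on the open `S ⊆ SU(N)` with an `SU(N)`-valued map `K` and has a strict real derivative
`D W` at `↑W`, `W ∈ S`, then for every traceless skew-Hermitian `X` the vector `D W (W X)` is tangent to `SU(N)` at `K W` in
the trace sense: `tr ((K W)* · D W (W X)) = 0` (differentiate `t ↦ det ((K W)* · Kmat (p (W cay (tX)))) ≡ 1` at `t = 0`).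
[folklore] -/
theorem trace_star_mul_apply_eq_zero {S : Set (Matrix.specialUnitaryGroup (Fin N) ℂ)} (hS : IsOpen S)
    {K : Matrix.specialUnitaryGroup (Fin N) ℂ → Matrix.specialUnitaryGroup (Fin N) ℂ} {Kmat : 𝕄 → 𝕄}
    {D : Matrix.specialUnitaryGroup (Fin N) ℂ → 𝕄 →L[ℝ] 𝕄} (hd : ∀ W ∈ S, HasStrictFDerivAt Kmat (D W) (W : 𝕄))
    (hKmat : ∀ W ∈ S, Kmat (W : 𝕄) = ((K W : Matrix.specialUnitaryGroup (Fin N) ℂ) : 𝕄))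
    {W : Matrix.specialUnitaryGroup (Fin N) ℂ} (hW : W ∈ S) {X : 𝕄} (hX : Xᴴ = -X) (htr : X.trace = 0) :
    (star ((K W : Matrix.specialUnitaryGroup (Fin N) ℂ) : 𝕄) * D W ((W : 𝕄) * X)).trace = 0 := by
  obtain ⟨O, hO, hOS⟩ := isOpen_induced_iff.mp hS
  have hWO : (W : 𝕄) ∈ O := by
    have h : W ∈ Subtype.val ⁻¹' O := by rw [hOS]; exact hW
    exact h
  have hWu : (W : 𝕄) ∈ Matrix.unitaryGroup (Fin N) ℂ := (Matrix.mem_specialUnitaryGroup_iff.mp W.2).1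
  have hWdet : (W : 𝕄).det = 1 := (Matrix.mem_specialUnitaryGroup_iff.mp W.2).2
  have hW1 : (W : 𝕄) * star (W : 𝕄) = 1 := Matrix.mem_unitaryGroup_iff.mp hWu
  have hW2 : star (W : 𝕄) * (W : 𝕄) = 1 := Matrix.mem_unitaryGroup_iff'.mp hWu
  have hAdet : ((K W : Matrix.specialUnitaryGroup (Fin N) ℂ) : 𝕄).det = 1 :=
    (Matrix.mem_specialUnitaryGroup_iff.mp (K W).2).2
  have hA2 : star ((K W : Matrix.specialUnitaryGroup (Fin N) ℂ) : 𝕄) * ((K W : Matrix.specialUnitaryGroup (Fin N) ℂ) : 𝕄)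
      = 1 := Matrix.mem_unitaryGroup_iff'.mp (Matrix.mem_specialUnitaryGroup_iff.mp (K W).2).1
  have hγmem : ∀ t : ℝ, projM ((W : 𝕄) * cay (t • X)) ∈ Matrix.specialUnitaryGroup (Fin N) ℂ := fun t =>
    projM_mem (Submonoid.mul_mem _ hWu (cay_mem_unitaryGroup (conjTranspose_real_smul hX t)))
  -- the chain rule along `t ↦ det ((K W)* · Kmat (p (W cay (t X))))`
  have h1 := (hasDerivAt_id (0 : ℝ)).smul_const X
  have hcay : HasStrictFDerivAt cay (cayD (0 : 𝕄)) (0 : 𝕄) :=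
    hasStrictFDerivAt_cay (isUnit_two_sub (by rw [Matrix.conjTranspose_zero, neg_zero]))
  have h2 := hcay.hasFDerivAt.comp_hasDerivAt_of_eq (0 : ℝ) h1 (by simp)
  have h3 := h2.const_mul (W : 𝕄)
  have h4 := (hasStrictFDerivAt_projM hW1 hW2).hasFDerivAt.comp_hasDerivAt_of_eq (0 : ℝ) h3
    (by simp only [Function.comp_apply, id_eq, zero_smul, cay_zero, Matrix.mul_one])
  have h5 := (hd W hW).hasFDerivAt.comp_hasDerivAt_of_eq (0 : ℝ) h4
    (by simp only [Function.comp_apply, id_eq, zero_smul, cay_zero, Matrix.mul_one]; rw [projM_eq_self W.2])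
  have h6 := h5.const_mul (star ((K W : Matrix.specialUnitaryGroup (Fin N) ℂ) : 𝕄))
  have h7 := (hasStrictFDerivAt_det_one (N := N)).hasFDerivAt.comp_hasDerivAt_of_eq (0 : ℝ) h6
    (by simp only [Function.comp_apply, id_eq, zero_smul, cay_zero, Matrix.mul_one]; rw [projM_eq_self W.2, hKmat W hW, hA2])
  -- the function is eventually constant `= 1`
  have hmemO := h4.continuousAt.preimage_mem_nhds (hO.mem_nhds (by
    simp only [Function.comp_apply, id_eq, zero_smul, cay_zero, Matrix.mul_one]; rw [projM_eq_self W.2]; exact hWO))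
  have h8 := h7.congr_of_eventuallyEq (f₁ := fun _ : ℝ => (1 : ℂ)) (by
    filter_upwards [hmemO] with t ht
    simp only [Set.mem_preimage, Function.comp_apply, id_eq] at ht ⊢
    have hmem : (⟨projM ((W : 𝕄) * cay (t • X)), hγmem t⟩ : Matrix.specialUnitaryGroup (Fin N) ℂ) ∈ S := by
      rw [← hOS]; exact ht
    rw [show Kmat (projM ((W : 𝕄) * cay (t • X)))
        = ((K ⟨projM ((W : 𝕄) * cay (t • X)), hγmem t⟩ : Matrix.specialUnitaryGroup (Fin N) ℂ) : 𝕄) from hKmat _ hmem,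
      Matrix.det_mul, Matrix.star_eq_conjTranspose, Matrix.det_conjTranspose, hAdet, star_one, one_mul,
      (Matrix.mem_specialUnitaryGroup_iff.mp (K _).2).2])
  have h9 := h8.unique (hasDerivAt_const (0 : ℝ) (1 : ℂ))
  rw [one_smul] at h9
  -- read off the derivative (bridging the coercion paths by a definitional step)
  have h10 : trD (N := N) (star ((K W : Matrix.specialUnitaryGroup (Fin N) ℂ) : 𝕄) * D W (projD (W : 𝕄) ((W : 𝕄) * X))) = 0 := by
    calc trD (N := N) (star ((K W : Matrix.specialUnitaryGroup (Fin N) ℂ) : 𝕄) * D W (projD (W : 𝕄) ((W : 𝕄) * X)))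
        = trD (N := N) (star ((K W : Matrix.specialUnitaryGroup (Fin N) ℂ) : 𝕄)
            * D W (projD (W : 𝕄) ((W : 𝕄) * cayD (0 : 𝕄) X))) := by rw [cayD_zero_apply]
      _ = 0 := h9
  rw [projD_apply_mul hWu hX, hWdet, twist_one htr, projM_eq_self W.2, trD_apply] at h10
  exact h10

end Tangency

/-! ## D. The Haar measure of `SU(N)` is the push-forward of the Haar measure of `U(N)` under `p` -/

section Haar

variable [NeZero N]

/-- **`p_* Haar_{U(N)} = Haar_{SU(N)}`**: `p` is left-`SU(N)`-equivariant and onto, so the push-forward is a left-invariant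
probability measure on the compact group `SU(N)`, hence its Haar probability measure (uniqueness). [folklore] -/
theorem map_toSU_haarProbability :
    (haarProbability (𝔾 N)).map toSU = haarProbability (Matrix.specialUnitaryGroup (Fin N) ℂ) := by
  have hmeas : Measurable (toSU (N := N)) := continuous_toSU.measurable
  set μ := (haarProbability (𝔾 N)).map toSU with hμ
  haveI : IsProbabilityMeasure μ := Measure.isProbabilityMeasure_map hmeas.aemeasurable
  haveI : μ.IsMulLeftInvariant := by
    refine ⟨fun g => ?_⟩
    have hg : Measurable fun x : Matrix.specialUnitaryGroup (Fin N) ℂ => g * x := (continuous_const.mul continuous_id).measurable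
    have hg' : Measurable fun U : 𝔾 N => incl g * U := (continuous_const.mul continuous_id).measurable
    rw [hμ, Measure.map_map hg hmeas]
    have : (fun x => g * x) ∘ toSU = toSU ∘ fun U : 𝔾 N => incl g * U := by
      funext U; exact (toSU_incl_mul g U).symm
    rw [this, ← Measure.map_map hmeas hg', map_mul_left_eq_self]
  haveI : SecondCountableTopology (Matrix.specialUnitaryGroup (Fin N) ℂ) := by
    haveI : SecondCountableTopology 𝕄 := inferInstanceAs (SecondCountableTopology (Fin N → Fin N → ℂ))
    exact Topology.IsEmbedding.subtypeVal.secondCountableTopology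
  have h := Measure.haarMeasure_unique μ (⊤ : TopologicalSpace.PositiveCompacts (Matrix.specialUnitaryGroup (Fin N) ℂ))
  rw [h, TopologicalSpace.PositiveCompacts.coe_top, measure_univ, one_smul]
  rfl

end Haar

/-! ## E. The main theorem on `SU(N)` -/

section Main

variable [NeZero N]

/-- **Injectivity transfer.** If `D W` (`W = p U`) kills no non-zero traceless skew tangent vector `W X̃`, then the derivative of
the lift at `U` kills no non-zero skew tangent vector `U X`: from `liftD (U X) = 0` one reads off
`D W (W X̃) = −(tr X) (K W) E₀`, the tangency `tr ((K W)* D W (W X̃)) = 0` forces `tr X = 0`, hence `D W (W X̃) = 0`, `X̃ = 0`,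
`X = 0`. [folklore] -/
theorem lift_tangent_injective {S : Set (Matrix.specialUnitaryGroup (Fin N) ℂ)} (hS : IsOpen S)
    {K : Matrix.specialUnitaryGroup (Fin N) ℂ → Matrix.specialUnitaryGroup (Fin N) ℂ} {Kmat : 𝕄 → 𝕄}
    {D : Matrix.specialUnitaryGroup (Fin N) ℂ → 𝕄 →L[ℝ] 𝕄} (hd : ∀ W ∈ S, HasStrictFDerivAt Kmat (D W) (W : 𝕄))
    (hKmat : ∀ W ∈ S, Kmat (W : 𝕄) = ((K W : Matrix.specialUnitaryGroup (Fin N) ℂ) : 𝕄))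
    (hinj : ∀ W ∈ S, ∀ X : 𝕄, Xᴴ = -X → X.trace = 0 → D W ((W : 𝕄) * X) = 0 → X = 0)
    {U : 𝔾 N} (hU : toSU U ∈ S) {X : 𝕄} (hX : Xᴴ = -X)
    (h0 : liftD Kmat (U : 𝕄) ((U : 𝕄) * X) = 0) : X = 0 := by
  have hUu : (U : 𝕄) ∈ Matrix.unitaryGroup (Fin N) ℂ := U.2
  have hU2 : star (U : 𝕄) * (U : 𝕄) = 1 := Matrix.mem_unitaryGroup_iff'.mp hUu
  have hcc : (U : 𝕄).det * star (U : 𝕄).det = 1 := det_mul_star_det hUu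
  have hcc' : star (U : 𝕄).det * (U : 𝕄).det = 1 := star_det_mul_det hUu
  have hA2 : star ((K (toSU U) : Matrix.specialUnitaryGroup (Fin N) ℂ) : 𝕄)
      * ((K (toSU U) : Matrix.specialUnitaryGroup (Fin N) ℂ) : 𝕄) = 1 :=
    Matrix.mem_unitaryGroup_iff'.mp (Matrix.mem_specialUnitaryGroup_iff.mp (K (toSU U)).2).1
  have hXt : (twist (U : 𝕄).det X)ᴴ = -twist (U : 𝕄).det X := conjTranspose_twist hX
  have hXtr : (twist (U : 𝕄).det X).trace = 0 := trace_twist hcc' X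
  rw [liftD_apply hUu (hd (toSU U) hU), detD_apply, ← Matrix.mul_assoc (star (U : 𝕄)), hU2, Matrix.one_mul,
    projD_apply_mul hUu hX, show projM (U : 𝕄) = ((toSU U : Matrix.specialUnitaryGroup (Fin N) ℂ) : 𝕄) from rfl,
    hKmat _ hU] at h0
  -- `H = −(tr X) • (A E₀)`
  have hE2 : D (toSU U) (((toSU U : Matrix.specialUnitaryGroup (Fin N) ℂ) : 𝕄) * twist (U : 𝕄).det X)
      = -(X.trace • (((K (toSU U) : Matrix.specialUnitaryGroup (Fin N) ℂ) : 𝕄) * E₀)) := by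
    have h1 := eq_neg_of_add_eq_zero_right h0
    calc D (toSU U) (((toSU U : Matrix.specialUnitaryGroup (Fin N) ℂ) : 𝕄) * twist (U : 𝕄).det X)
        = D (toSU U) (((toSU U : Matrix.specialUnitaryGroup (Fin N) ℂ) : 𝕄) * twist (U : 𝕄).det X) * dmat (U : 𝕄).det
            * dmat (star (U : 𝕄).det) := by
          rw [Matrix.mul_assoc, dmat_mul_dmat, hcc, dmat_one, Matrix.mul_one]
      _ = -(((K (toSU U) : Matrix.specialUnitaryGroup (Fin N) ℂ) : 𝕄) * (((U : 𝕄).det * X.trace) • (E₀ : 𝕄)))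
            * dmat (star (U : 𝕄).det) := by rw [h1]
      _ = -(X.trace • (((K (toSU U) : Matrix.specialUnitaryGroup (Fin N) ℂ) : 𝕄) * E₀)) := by
          rw [Matrix.neg_mul, Matrix.mul_assoc, Matrix.smul_mul, E₀_mul_dmat, smul_smul, Matrix.mul_smul, mul_right_comm,
            hcc, one_mul]
  -- tangency forces `tr X = 0`
  have htan := trace_star_mul_apply_eq_zero hS hd hKmat hU hXt hXtr
  have htrX : X.trace = 0 := by
    rw [hE2, Matrix.mul_neg, Matrix.mul_smul, ← Matrix.mul_assoc, hA2, Matrix.one_mul, Matrix.trace_neg,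
      Matrix.trace_smul, trace_E₀, smul_eq_mul, mul_one, neg_eq_zero] at htan
    exact htan
  have hH0 : D (toSU U) (((toSU U : Matrix.specialUnitaryGroup (Fin N) ℂ) : 𝕄) * twist (U : 𝕄).det X) = 0 := by
    rw [hE2, htrX, zero_smul, neg_zero]
  have hXt0 : twist (U : 𝕄).det X = 0 := hinj _ hU _ hXt hXtr hH0
  rw [← dmat_mul_twist_mul_dmat hcc' htrX, hXt0, Matrix.mul_zero, Matrix.zero_mul]

/-- **MAIN THEOREM (Lemma A on `SU(N)`, every `N ≥ 1`).** Let `S ⊆ SU(N)` be open and `K : SU(N) → SU(N)` measurable.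
Suppose an ambient map `Kmat : M_N(ℂ) → M_N(ℂ)` has a strict real Fréchet derivative `D W` at `↑W` for every `W ∈ S`,
agrees with `K` on `S`, and `D W` is injective on the tangent space `W · 𝔰𝔲(N)` (traceless skew-Hermitian `X`). Then the
push-forward under `K` of the Haar probability measure restricted to `S` is absolutely continuous:
`((Haar).restrict S).map K ≪ Haar`. Proof: transfer to `U(N)` along `p : U ↦ U·d(det U)⁻¹` (`p_* Haar = Haar`,
`p (K̂ U) = K (p U)` for the lift `K̂ U = K(p U)·d(det U)`) and apply `haar_restrict_map_absolutelyContinuous_unitary` to `K̂`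
on `p⁻¹(S)`, whose tangent injectivity is `lift_tangent_injective`. [folklore] -/
theorem haar_restrict_map_absolutelyContinuous_specialUnitary {S : Set (Matrix.specialUnitaryGroup (Fin N) ℂ)}
    (hS : IsOpen S) {K : Matrix.specialUnitaryGroup (Fin N) ℂ → Matrix.specialUnitaryGroup (Fin N) ℂ} (hK : Measurable K)
    {Kmat : 𝕄 → 𝕄} {D : Matrix.specialUnitaryGroup (Fin N) ℂ → 𝕄 →L[ℝ] 𝕄}
    (hd : ∀ W ∈ S, HasStrictFDerivAt Kmat (D W) (W : 𝕄))
    (hKmat : ∀ W ∈ S, Kmat (W : 𝕄) = ((K W : Matrix.specialUnitaryGroup (Fin N) ℂ) : 𝕄))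
    (hinj : ∀ W ∈ S, ∀ X : 𝕄, Xᴴ = -X → X.trace = 0 → D W ((W : 𝕄) * X) = 0 → X = 0) :
    ((haarProbability (Matrix.specialUnitaryGroup (Fin N) ℂ)).restrict S).map K
      ≪ haarProbability (Matrix.specialUnitaryGroup (Fin N) ℂ) := by
  have hmeas : Measurable (toSU (N := N)) := continuous_toSU.measurable
  refine Measure.AbsolutelyContinuous.mk fun T hT hT0 => ?_
  rw [Measure.map_apply hK hT, Measure.restrict_apply (hK hT)]
  have hT0' : haarProbability (𝔾 N) (toSU ⁻¹' T) = 0 := by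
    rw [← Measure.map_apply hmeas hT, map_toSU_haarProbability]; exact hT0
  rw [← map_toSU_haarProbability, Measure.map_apply hmeas ((hK hT).inter hS.measurableSet)]
  have hset : toSU ⁻¹' (K ⁻¹' T ∩ S) = lift K ⁻¹' (toSU ⁻¹' T) ∩ toSU ⁻¹' S := by
    ext U
    simp only [Set.mem_preimage, Set.mem_inter_iff, toSU_lift]
  rw [hset]
  have hAC := haar_restrict_map_absolutelyContinuous_unitary (hS.preimage continuous_toSU) (measurable_lift hK)
    (Kmat := liftM Kmat) (D := fun U => liftD Kmat (U : 𝕄))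
    (fun U hU => hasStrictFDerivAt_liftM U.2 (hd (toSU U) hU))
    (fun U hU => by
      rw [coe_lift]
      show Kmat (toSU U : 𝕄) * dmat (U : 𝕄).det = _
      rw [hKmat _ hU])
    (fun U hU X hX h0 => lift_tangent_injective hS hd hKmat hinj hU hX h0)
  have h := hAC hT0'
  rwa [Measure.map_apply (measurable_lift hK) (hmeas hT),
    Measure.restrict_apply ((measurable_lift hK) (hmeas hT))] at h

/-- **Corollary (`S = SU(N)`).** A measurable `K : SU(N) → SU(N)` with an everywhere strictly differentiable ambient
representative whose derivative is injective on every tangent space pushes the Haar measure forward to an absolutely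
continuous measure. [folklore] -/
theorem haar_map_absolutelyContinuous_specialUnitary
    {K : Matrix.specialUnitaryGroup (Fin N) ℂ → Matrix.specialUnitaryGroup (Fin N) ℂ} (hK : Measurable K)
    {Kmat : 𝕄 → 𝕄} {D : Matrix.specialUnitaryGroup (Fin N) ℂ → 𝕄 →L[ℝ] 𝕄}
    (hd : ∀ W : Matrix.specialUnitaryGroup (Fin N) ℂ, HasStrictFDerivAt Kmat (D W) (W : 𝕄))
    (hKmat : ∀ W : Matrix.specialUnitaryGroup (Fin N) ℂ, Kmat (W : 𝕄) = ((K W : Matrix.specialUnitaryGroup (Fin N) ℂ) : 𝕄))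
    (hinj : ∀ W : Matrix.specialUnitaryGroup (Fin N) ℂ, ∀ X : 𝕄, Xᴴ = -X → X.trace = 0 → D W ((W : 𝕄) * X) = 0 → X = 0) :
    (haarProbability (Matrix.specialUnitaryGroup (Fin N) ℂ)).map K ≪ haarProbability (Matrix.specialUnitaryGroup (Fin N) ℂ) := by
  have h := haar_restrict_map_absolutelyContinuous_specialUnitary (S := Set.univ) isOpen_univ hK
    (fun W _ => hd W) (fun W _ => hKmat W) (fun W _ => hinj W)
  rwa [Measure.restrict_univ] at h

end Main


end Literature.MathematicalPhysics.QuantumFieldTheory.Balaban1983to89.T4HaarSUNLocalDiffeo
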